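import Mathlib
import Summits.Parity.GeneralizedHardyLittlewood.Theses.LiouvilleShiftedTables
import Summits.Parity.GeneralizedHardyLittlewood.Theorems.DilatedTableChowla.Negative.DilatedTableChowlaBlocks
import Summits.Parity.GeneralizedHardyLittlewood.Theorems.TableChowla.Negative.TableChowlaAperiodicVacuity

/-!
# Crux-triage r2, triager 2 — kernel-checked evidence for crux stmt-Parity-14271 `DilatedTableChowla`

Cards attacked: `dilated-symbol-normal-form` (§1) and `cm-dichotomy-sections` (§2), both by ideator 4
(`Cruxes/DilatedTableChowla/SketchIdeator4.lean`).  The `Prop`s below are VERBATIM copies of that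
Sketch's definitions (same notation `L`, `rows`, `cols`, `lhs` from the landed
`Negative.DilatedTableChowlaBlocks`), so every statement proved here applies to the Sketch's `Prop`s by
`Iff.rfl`.

* §1 (card 1): BOTH typed halves of the "exact split" contain the rank-2 crux `TableChowla`
  (stmt-Parity-14270) — the `q = 1` table is a zero class (`1 ∣ anything`) and the non-zero half only
  constrains `q ≥ 2` while its `lhs` still carries the `q = 1` term.  So neither half is a sub-crux piece:
  `min(stubs) ⊇ stmt-Parity-14270` (all lines dead, conjecture-grade by `fixedResidueFace_of_tableChowla`).
* §2 (card 2): the periodic/aperiodic cut `IsPeriodicUpTo` is a GLOBAL property of the weight `g`, hence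
  VOID on the columns by the kill-prime trick of the sibling's landed
  `TableChowla.Negative.TableChowlaAperiodicVacuity` (p74937): for every `K`,
  `AperiodicSections → (bound for ALL CM weights) → PeriodicSections`.  The card's "closable spine"
  (`RelativeLinnikData → ThinFamilyBV → PeriodicSections`) is logically idle in `CardTwoAssembly` as typed.
-/

namespace Triage22

open Finset
open Summit.Parity.GeneralizedHardyLittlewood.Theses.LiouvilleShiftedTables
open Summit.Parity.GeneralizedHardyLittlewood.Theorems.DilatedTableChowla.Negative
open Summit.Parity.GeneralizedHardyLittlewood.Theorems.TableChowla.Negative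
  (killPrime killPrime_mul norm_killPrime_le aperiodic_killPrime killPrime_of_not_dvd)

/-! ## §1 Card `dilated-symbol-normal-form`: both halves contain `TableChowla` -/

/-- VERBATIM `SketchIdeator4.ZeroClassDilated`. -/
def ZeroClassDilated : Prop :=
  ∀ c : ℤ, c ≠ 0 → ∀ δ : ℝ, 0 < δ → δ ≤ 1 / 12 → ∀ C : ℝ, 0 < C → ∃ x₀ : ℝ, ∀ x : ℝ, x₀ ≤ x →
    ∀ A : ℝ, x ^ δ ≤ A → A ≤ x ^ (1 / 3 + δ) → ∀ u v : ℕ → ℕ,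
      (∀ q : ℕ, 1 ≤ q → (q : ℤ) ∣ (u q : ℤ) * (v q : ℤ) + c) →
        lhs c δ x A u v ≤ x ^ 2 / Real.log x ^ C

/-- VERBATIM `SketchIdeator4.NonzeroClassDilated`. -/
def NonzeroClassDilated : Prop :=
  ∀ c : ℤ, c ≠ 0 → ∀ δ : ℝ, 0 < δ → δ ≤ 1 / 12 → ∀ C : ℝ, 0 < C → ∃ x₀ : ℝ, ∀ x : ℝ, x₀ ≤ x →
    ∀ A : ℝ, x ^ δ ≤ A → A ≤ x ^ (1 / 3 + δ) → ∀ u v : ℕ → ℕ,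
      (∀ q : ℕ, 2 ≤ q → ¬ (q : ℤ) ∣ (u q : ℤ) * (v q : ℤ) + c) →
        lhs c δ x A u v ≤ x ^ 2 / Real.log x ^ C

/-- A zero-class selector exists at every dilation: `u ≡ 1`, `v q = (−c) mod q`. -/
theorem zeroSelector_dvd (c : ℤ) (q : ℕ) (hq : 1 ≤ q) :
    (q : ℤ) ∣ ((1 : ℕ) : ℤ) * ((Int.toNat ((-c) % (q : ℤ)) : ℕ) : ℤ) + c := by
  have hq0 : (q : ℤ) ≠ 0 := by exact_mod_cast (by omega : q ≠ 0)
  have hnn : 0 ≤ (-c) % (q : ℤ) := Int.emod_nonneg _ hq0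
  rw [Int.toNat_of_nonneg hnn]
  have key := Int.emod_add_ediv_mul (-c) (q : ℤ)
  exact ⟨-((-c) / (q : ℤ)), by push_cast; linear_combination key⟩

/-- A NON-zero-class selector exists at every dilation `q ≥ 2`: `(u,v) = (1,1)` if `q ∣ c`, else `(0,0)`. -/
theorem nonzeroSelector_not_dvd (c : ℤ) (q : ℕ) (hq : 2 ≤ q) :
    ¬ (q : ℤ) ∣ ((if (q : ℤ) ∣ c then 1 else 0 : ℕ) : ℤ) * ((if (q : ℤ) ∣ c then 1 else 0 : ℕ) : ℤ) + c := by
  by_cases h : (q : ℤ) ∣ c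
  · simp only [h, if_true, Nat.cast_one, one_mul]
    intro h'
    have h1 : (q : ℤ) ∣ 1 := by
      have := dvd_sub h' h
      simpa using this
    have hq1 : (q : ℤ) = 1 := Int.eq_one_of_dvd_one (by positivity) h1
    have : q = 1 := by exact_mod_cast hq1
    omega
  · simp [h]

/-- The ZERO half of the split contains the rank-2 crux: `ZeroClassDilated → TableChowla`. -/
theorem tableChowla_of_zeroClassDilated (h : ZeroClassDilated) : TableChowla := by
  intro c hc δ hδ hδ' C hC
  obtain ⟨x₀, hx₀⟩ := h c hc δ hδ hδ' C hC
  refine ⟨max x₀ 1, fun x hx A hA hA' => ?_⟩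
  have hx1 : (1 : ℝ) ≤ x := le_trans (le_max_right _ _) hx
  let u : ℕ → ℕ := fun _ => 1
  let v : ℕ → ℕ := fun q => Int.toNat ((-c) % (q : ℤ))
  have hsel : ∀ q : ℕ, 1 ≤ q → (q : ℤ) ∣ (u q : ℤ) * (v q : ℤ) + c := fun q hq =>
    zeroSelector_dvd c q hq
  have hb := hx₀ x (le_trans (le_max_left _ _) hx) A hA hA' u v hsel
  have h1 := F_one_le_lhs c hδ.le hx1 A u v
  rw [F_one_eq_table] at h1
  exact h1.trans hb

/-- The NON-ZERO half of the split ALSO contains the rank-2 crux: `NonzeroClassDilated → TableChowla`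
(its selector constraint starts at `q = 2`; the `q = 1` term of `lhs` is the full table). -/
theorem tableChowla_of_nonzeroClassDilated (h : NonzeroClassDilated) : TableChowla := by
  intro c hc δ hδ hδ' C hC
  obtain ⟨x₀, hx₀⟩ := h c hc δ hδ hδ' C hC
  refine ⟨max x₀ 1, fun x hx A hA hA' => ?_⟩
  have hx1 : (1 : ℝ) ≤ x := le_trans (le_max_right _ _) hx
  let u : ℕ → ℕ := fun q => if (q : ℤ) ∣ c then 1 else 0
  have hsel : ∀ q : ℕ, 2 ≤ q → ¬ (q : ℤ) ∣ (u q : ℤ) * (u q : ℤ) + c := fun q hq =>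
    nonzeroSelector_not_dvd c q hq
  have hb := hx₀ x (le_trans (le_max_left _ _) hx) A hA hA' u u hsel
  have h1 := F_one_le_lhs c hδ.le hx1 A u u
  rw [F_one_eq_table] at h1
  exact h1.trans hb

/-- Trivially the crux gives both halves (the Sketch's `halves_of_crux`), so with
`Negative.crux ⟹ TableChowla` nothing is lost: each half is sandwiched
`DilatedTableChowla ⟹ half ⟹ TableChowla`. -/
theorem halves_of_crux (h : DilatedTableChowla) : ZeroClassDilated ∧ NonzeroClassDilated := by
  refine ⟨?_, ?_⟩
  · intro c hc δ hδ hδ' C hC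
    obtain ⟨x₀, hx₀⟩ := (crux_iff_lhs.1 h) c hc δ hδ hδ' C hC
    exact ⟨x₀, fun x hx A hA hA' u v _ => hx₀ x hx A hA hA' u v⟩
  · intro c hc δ hδ hδ' C hC
    obtain ⟨x₀, hx₀⟩ := (crux_iff_lhs.1 h) c hc δ hδ hδ' C hC
    exact ⟨x₀, fun x hx A hA hA' u v _ => hx₀ x hx A hA hA' u v⟩

/-! ## §2 Card `cm-dichotomy-sections`: the `IsPeriodicUpTo` cut is void (kill-prime) -/

/-- VERBATIM `SketchIdeator4.IsPeriodicUpTo`: a GLOBAL periodicity property of `g`. -/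
def IsPeriodicUpTo (g : ℕ → ℂ) (P : ℝ) : Prop := ∃ p : ℕ, 1 ≤ p ∧ (p : ℝ) ≤ P ∧ ∀ n, g (n + p) = g n

/-- VERBATIM `SketchIdeator4.PeriodicSections`. -/
def PeriodicSections (c : ℤ) (x A : ℝ) (q u v : ℕ) (C' K : ℝ) : Prop :=
  ∀ g : ℕ → ℂ, g 1 = 1 → (∀ m n : ℕ, g (m * n) = g m * g n) → (∀ n, ‖g n‖ ≤ 1) →
    IsPeriodicUpTo g (Real.log x ^ K) → ∀ y : ℝ, 0 ≤ y → y ≤ x / A →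
      (∑ a ∈ rows A q u, ‖∑ b ∈ (cols x A q v).filter (fun b : ℕ => (b : ℝ) ≤ y),
          g b * (L ((a : ℤ) * b + c) : ℂ)‖ ^ 2) < (A / q) * (x / (A * q)) ^ 2 / Real.log x ^ C'

/-- VERBATIM `SketchIdeator4.AperiodicSections`. -/
def AperiodicSections (c : ℤ) (x A : ℝ) (q u v : ℕ) (C' K : ℝ) : Prop :=
  ∀ g : ℕ → ℂ, g 1 = 1 → (∀ m n : ℕ, g (m * n) = g m * g n) → (∀ n, ‖g n‖ ≤ 1) →
    ¬ IsPeriodicUpTo g (Real.log x ^ K) → ∀ y : ℝ, 0 ≤ y → y ≤ x / A →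
      (∑ a ∈ rows A q u, ‖∑ b ∈ (cols x A q v).filter (fun b : ℕ => (b : ℝ) ≤ y),
          g b * (L ((a : ℤ) * b + c) : ℂ)‖ ^ 2) < (A / q) * (x / (A * q)) ^ 2 / Real.log x ^ C'

/-- The same bound for EVERY completely multiplicative 1-bounded weight (no periodicity cut). -/
def AllCMSections (c : ℤ) (x A : ℝ) (q u v : ℕ) (C' : ℝ) : Prop :=
  ∀ g : ℕ → ℂ, g 1 = 1 → (∀ m n : ℕ, g (m * n) = g m * g n) → (∀ n, ‖g n‖ ≤ 1) →
    ∀ y : ℝ, 0 ≤ y → y ≤ x / A →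
      (∑ a ∈ rows A q u, ‖∑ b ∈ (cols x A q v).filter (fun b : ℕ => (b : ℝ) ≤ y),
          g b * (L ((a : ℤ) * b + c) : ℂ)‖ ^ 2) < (A / q) * (x / (A * q)) ^ 2 / Real.log x ^ C'

/-- KILL-PRIME: `killPrime g p` is not `IsPeriodicUpTo … P` once `p` is a prime beyond `⌊P⌋₊` and `g 1 ≠ 0`. -/
theorem not_isPeriodicUpTo_killPrime {g : ℕ → ℂ} (hg1 : g 1 ≠ 0) {p : ℕ} (hp : p.Prime) {P : ℝ}
    (hpP : ⌊P⌋₊ < p) : ¬ IsPeriodicUpTo (killPrime g p) P := by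
  rintro ⟨r, hr1, hrP, hper⟩
  have hrp : r < p := lt_of_le_of_lt (Nat.le_floor hrP) hpP
  exact aperiodic_killPrime hg1 hp hr1 hrp hper

/-- MAIN: for every `K`, the aperiodic residual already bounds EVERY CM weight (kill a prime
`p > max(⌊x/A⌋₊, ⌊(log x)^K⌋₊)`: the new weight is CM, 1-bounded, `g' 1 = 1`, NOT `IsPeriodicUpTo`,
and agrees with `g` on the columns `b ≤ ⌊x/A⌋ < p`). -/
theorem allCM_of_aperiodic {c : ℤ} {x A : ℝ} {q u v : ℕ} {C' K : ℝ}
    (h : AperiodicSections c x A q u v C' K) : AllCMSections c x A q u v C' := by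
  intro g hg1 hgm hgb y hy0 hyx
  obtain ⟨p, hpN, hp⟩ := Nat.exists_infinite_primes (max ⌊x / A⌋₊ ⌊Real.log x ^ K⌋₊ + 1)
  have hpy : ⌊x / A⌋₊ < p := by
    have := le_max_left ⌊x / A⌋₊ ⌊Real.log x ^ K⌋₊; omega
  have hpK : ⌊Real.log x ^ K⌋₊ < p := by
    have := le_max_right ⌊x / A⌋₊ ⌊Real.log x ^ K⌋₊; omega
  have hg1' : g 1 ≠ 0 := by rw [hg1]; exact one_ne_zero
  have h1 : killPrime g p 1 = 1 := by rw [killPrime_of_not_dvd hp.not_dvd_one, hg1]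
  have hbound := h (killPrime g p) h1 (killPrime_mul hgm hp) (norm_killPrime_le hgb p)
    (not_isPeriodicUpTo_killPrime hg1' hp hpK) y hy0 hyx
  have hsame : ∀ a : ℕ, ∑ b ∈ (cols x A q v).filter (fun b : ℕ => (b : ℝ) ≤ y),
      killPrime g p b * (L ((a : ℤ) * b + c) : ℂ) =
      ∑ b ∈ (cols x A q v).filter (fun b : ℕ => (b : ℝ) ≤ y), g b * (L ((a : ℤ) * b + c) : ℂ) := by
    intro a
    refine sum_congr rfl fun b hb => ?_
    have hb' : b ∈ cols x A q v := (Finset.mem_filter.1 hb).1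
    rw [mem_cols] at hb'
    have hbp : ¬ p ∣ b := fun hd => by
      have := Nat.le_of_dvd (by omega) hd
      omega
    rw [killPrime_of_not_dvd hbp]
  simp_rw [hsame] at hbound
  exact hbound

/-- Hence the "closable spine" conjunct is REDUNDANT: `AperiodicSections → PeriodicSections`, every `K`. -/
theorem periodicSections_of_aperiodic {c : ℤ} {x A : ℝ} {q u v : ℕ} {C' K : ℝ}
    (h : AperiodicSections c x A q u v C' K) : PeriodicSections c x A q u v C' K :=
  fun g hg1 hgm hgb _ y hy0 hyx => allCM_of_aperiodic h g hg1 hgm hgb y hy0 hyx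

/-- … and the aperiodic stub IS the whole CM residual of the section, for every `K`. -/
theorem aperiodicSections_iff_allCM {c : ℤ} {x A : ℝ} {q u v : ℕ} {C' K : ℝ} :
    AperiodicSections c x A q u v C' K ↔ AllCMSections c x A q u v C' :=
  ⟨allCM_of_aperiodic, fun h g hg1 hgm hgb _ y hy0 hyx => h g hg1 hgm hgb y hy0 hyx⟩

/-- COLLAPSE of the second hypothesis of `CardTwoAssembly` at every `(q; u, v)`:
`PeriodicSections ∧ AperiodicSections ↔ AperiodicSections`. -/
theorem residuals_iff_aperiodic {c : ℤ} {x A : ℝ} {q u v : ℕ} {C' K : ℝ} :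
    (PeriodicSections c x A q u v C' K ∧ AperiodicSections c x A q u v C' K) ↔
      AperiodicSections c x A q u v C' K :=
  ⟨fun h => h.2, fun h => ⟨periodicSections_of_aperiodic h, h⟩⟩

end Triage22
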